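import Literature.AlgebraicGeometry.Resolution.NonPrincipalLocus
import HarnessLib

/-!
# A sequence of blowing ups along centres in the non-principal locus of `J` is an isomorphism off `V(J)`

Topic: `Literature/AlgebraicGeometry/Resolution`. PROOF side of `CossartPiltant2019ReductionP`
(`ArithmeticalThreefoldsLocal.lean`), input (C4), [CoP1] Prop. 8.1 (1) (V. Cossart,
O. Piltant, HAL hal-00139124, p. 22): "`S₁ < S₂`, `(S₁)_f = (S₂)_f`" — the principalizing
sequence of blowing ups of [CoP1] Prop. 4.2 / Cossart–Piltant 2019 Prop. 4.4
(`CossartPiltant2019Principalization`, whose centres lie in the non-locally-principal locus of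
the transforms of `J`, `IsRegularCentreBlowupSeq`) is an ISOMORPHISM OVER THE COMPLEMENT OF
`V(J)`. This is the scheme-level input of the denominator control of
`ModelDenominatorTracking.lean` (exceptional primes of the new local uniformization contain
`J`). PROVED by induction over the sequence from Stacks 02OS (`IsBlowup.isIso_morphismRestrict`)
and the remark that an ideal sheaf is locally principal (indeed the unit ideal) off its support
(`isLocallyPrincipalAt_of_not_mem_support`, `NonPrincipalLocus.lean`).

Everything is PROVED; no named facts, definitions, instances or notation are introduced.

## Sources

* V. Cossart, O. Piltant, J. Algebra 320 (2008) 1051–1082: Prop. 4.2 and Prop. 8.1 (1) (HAL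
  hal-00139124, pp. 7, 22). [CossartPiltant2008]
* The Stacks Project, Tag 02OS. [StacksProject]
-/

noncomputable section

open CategoryTheory CategoryTheory.Limits AlgebraicGeometry TopologicalSpace

namespace Literature.AlgebraicGeometry.Resolution

universe u

/-- **A sequence of blowing ups along regular centres lying in the non-principal locus of (the
transforms of) `J` restricts to an isomorphism over the complement of the support of `J`**
([CoP1] Prop. 8.1 (1): the local uniformizations produced by Prop. 4.2 satisfy
"`(S₁)_f = (S₂)_f`" over `D(f) ⊇ D(J)`). [cite: CossartPiltant2008, Prop. 4.2 and Prop. 8.1 (1) (HAL pp. 7, 22)] -/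
theorem IsRegularCentreBlowupSeq.isIso_morphismRestrict_compl_support {S' S : Scheme.{u}}
    {σ : S' ⟶ S} {J : S.IdealSheafData} (h : IsRegularCentreBlowupSeq σ J) :
    IsIso (σ ∣_ ⟨(J.support : Set S)ᶜ, J.support.isClosed.isOpen_compl⟩) := by
  induction h with
  | nil J =>
    rw [morphismRestrict_id]
    exact IsIso.id _
  | @cons S₂ S₁ S₀ τ σ J Y hσ hint hreg hY hτ ih =>
    rw [morphismRestrict_comp]
    have hdisj : Disjoint
        ((σ ⁻¹ᵁ (⟨(J.support : Set S₀)ᶜ, J.support.isClosed.isOpen_compl⟩ : S₀.Opens) :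
          S₁.Opens) : Set S₁)
        ((Scheme.IdealSheafData.vanishingIdeal Y).support : Set S₁) := by
      rw [Set.disjoint_left]
      intro y hyV hyY
      have hyY' : y ∈ (Y : Set S₁) := by simpa using hyY
      refine hY y hyY' (isLocallyPrincipalAt_of_not_mem_support (J := J.comap σ) ?_)
      rw [Scheme.IdealSheafData.support_comap]
      exact hyV
    refine @IsIso.comp_isIso _ _ _ _ _ _ _ ?_ ih
    exact hτ.isIso_morphismRestrict hdisj

/-- For a sequence of blowing ups along regular centres in the non-principal locus of `J`,
the stalk map at every point lying over the complement of the support of `J` is an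
isomorphism. [cite: CossartPiltant2008, Prop. 4.2 and Prop. 8.1 (1) (HAL pp. 7, 22)] -/
theorem IsRegularCentreBlowupSeq.isIso_stalkMap_of_not_mem_support {S' S : Scheme.{u}}
    {σ : S' ⟶ S} {J : S.IdealSheafData} (h : IsRegularCentreBlowupSeq σ J) (y : S')
    (hy : σ y ∉ J.support) : IsIso (σ.stalkMap y) :=
  haveI := h.isIso_morphismRestrict_compl_support
  isIso_stalkMap_of_isIso_morphismRestrict σ
    ⟨(J.support : Set S)ᶜ, J.support.isClosed.isOpen_compl⟩ y hy

end Literature.AlgebraicGeometry.Resolution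

end
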